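import Mathlib
import Summits.PneNP.PneNP.Theorems.SfmBlProp7Legs

/-!
# Proposition 7 for `ℓ` legs per output, by SCALING — line «sfm-bl» made parametric (cell pnp-ideate,
# ROUND-18 item K1'' `SignDeg2Signing.SignDeg2SigningFP`, stage S2)

FRONTIER (range avoidance for sign-degree-≤2 local maps at linear stretch; restricted-model algorithmic
rung); nothing here bears on P vs NP.

p3's Prop. 7 (`SfmBl.sum_trace_pow_le_explicit`, the averaged trace-power bound for the sparse remainder) is
stated in the abstract output-shared-sign model `M_T = sgnMat B T` with REAL nonnegative leg matrices `B_j` of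
entry sum `≤ 3`.  For a leg system with `≤ ℓ` legs per output (`ℓ ≥ 3`) the leg-count matrices `B_j` have
entry sum `≤ ℓ`, and the RESCALED matrices `B′_j = (3/ℓ)·B_j` satisfy every hypothesis of Prop. 7 with the
same degree cap `L`, the same support graph and the sparseness threshold scaled by `3/ℓ`; since
`sgnMat B′ T = (3/ℓ)·M_T` and `tr((c·A)^{2k}) = c^{2k}·tr(A^{2k})`, Prop. 7 for `ℓ` legs follows with the
factor `(ℓ/3)^{2k}` — NO re-proof of the closed-walk counting.  Result: `sum_trace_pow_le_legs_ell`.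
-/

set_option linter.dupNamespace false -- `Summit.PneNP.PneNP.…`: summit = sub-problem name (D-0017 single-conjunct layout)

namespace Summit.PneNP.PneNP.Theorems.Sd2Bl

open Matrix Finset BigOperators
open Summit.PneNP.PneNP.Theorems.CandCutNorm Summit.PneNP.PneNP.Theorems.SfmBl

variable {α β : Type} [Fintype α] [Fintype β] [DecidableEq α] [DecidableEq β]
variable {E : Type*} [Fintype E] {m : ℕ}

omit [Fintype α] [Fintype β] [DecidableEq α] [DecidableEq β] in
/-- Scaling the leg matrices scales the signed biadjacency: `sgnMat (c·B) T = c·sgnMat B T`. -/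
theorem sgnMat_smul (B : Fin m → Matrix α β ℝ) (c : ℝ) (T : Fin m → Bool) :
    sgnMat (fun j => c • B j) T = c • sgnMat B T := by
  ext i k
  simp only [sgnMat_apply, Matrix.smul_apply, smul_eq_mul, Finset.mul_sum]
  exact Finset.sum_congr rfl fun j _ => by ring

omit [Fintype α] [Fintype β] [DecidableEq α] [DecidableEq β] in
/-- Scaling the off-diagonal blocks scales the symmetric dilation. -/
theorem fromBlocks_smul_offDiag (M : Matrix α β ℝ) (c : ℝ) :
    Matrix.fromBlocks (0 : Matrix α α ℝ) (c • M) (c • M)ᵀ (0 : Matrix β β ℝ)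
      = c • Matrix.fromBlocks (0 : Matrix α α ℝ) M Mᵀ (0 : Matrix β β ℝ) := by
  rw [Matrix.fromBlocks_smul, smul_zero, smul_zero, Matrix.transpose_smul]

/-- **PROPOSITION 7 FOR `ℓ` LEGS PER OUTPUT** (`3 ≤ ℓ`).  Legs `e : E` with `src, dst, out`; `≤ ℓ` legs per
output; leg-degrees `≤ L₀ ≤ L`; a graph `G ⊇` all legs with degrees `≤ Ldeg ≤ L`; `2 ≤ L`; thresholds
`0 ≤ γ′` with `γ′² ≥ 144·L·ln L` and a REMAINDER SPARSENESS scale `γR` with `γ′·ℓ ≤ 3γR`, `3γR ≤ ℓ·L`: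
every `G`-connected pair of total size `≤ t₀` has `e(W₁,W₂) ≤ γR·√(|W₁||W₂|)`.  Then, with `γsp := 3γR/ℓ`,
`Σ_T tr((fromBlocks 0 M_T M_Tᵀ 0)^{2k}) ≤ (ℓ/3)^{2k}·(2^m·N·ρ^{2k} + 2^m·4N²L^{2k}/L^{10(t₀+1)+2})`,
`ρ = 100·γsp·(log₂(L/γsp)+1)`, `N = |α|+|β|`. -/
theorem sum_trace_pow_le_legs_ell (src : E → α) (dst : E → β) (out : E → Fin m)
    {ℓ : ℕ} (hℓ : 3 ≤ ℓ) (hout : ∀ j : Fin m, (Finset.univ.filter fun e => out e = j).card ≤ ℓ)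
    {L₀ : ℕ} (hdeg₁ : ∀ i, (Finset.univ.filter fun e => src e = i).card ≤ L₀)
    (hdeg₂ : ∀ k, (Finset.univ.filter fun e => dst e = k).card ≤ L₀)
    {L : ℝ} (hL : 2 ≤ L) (hL₀ : (L₀ : ℝ) ≤ L)
    (G : SimpleGraph (α ⊕ β)) [DecidableRel G.Adj] (hG : ∀ e, G.Adj (Sum.inl (src e)) (Sum.inr (dst e)))
    {Ldeg : ℕ} (hGdeg : ∀ x, G.degree x ≤ Ldeg) (hLdeg : (Ldeg : ℝ) ≤ L)
    {γ' γR : ℝ} (hγ' : 0 ≤ γ') (hγ'L : 144 * L * Real.log L ≤ γ' ^ 2) (hγR : γ' * ℓ ≤ 3 * γR)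
    (hγRL : 3 * γR ≤ ℓ * L) (t₀ : ℕ)
    (hsparse : ∀ (W₁ : Finset α) (W₂ : Finset β),
      (G.induce {x | Sum.elim (fun i => i ∈ W₁) (fun j => j ∈ W₂) x}).Connected →
      W₁.card + W₂.card ≤ t₀ →
      ((Finset.univ.filter fun e => src e ∈ W₁ ∧ dst e ∈ W₂).card : ℝ)
        ≤ γR * Real.sqrt ((W₁.card : ℝ) * (W₂.card : ℝ)))
    (M : (Fin m → Bool) → Matrix α β ℝ)
    (hM : ∀ T i k, M T i k = ∑ e ∈ Finset.univ.filter (fun e => src e = i ∧ dst e = k),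
      ((boolSign (T (out e)) : ℤ) : ℝ))
    (k : ℕ) :
    ∑ T : Fin m → Bool,
        ((Matrix.fromBlocks (0 : Matrix α α ℝ) (M T) (M T)ᵀ (0 : Matrix β β ℝ)) ^ (2 * k)).trace
      ≤ ((ℓ : ℝ) / 3) ^ (2 * k) *
        (2 ^ m * ((Fintype.card α + Fintype.card β)
            * (100 * ((3 * γR / ℓ) * (Real.logb 2 (L / (3 * γR / ℓ)) + 1))) ^ (2 * k))
          + 2 ^ m * (4 * (Fintype.card α + Fintype.card β) ^ 2 * L ^ (2 * k)
            * (L ^ (10 * (t₀ + 1) + 2))⁻¹)) := by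
  classical
  have hℓpos : (0 : ℝ) < ℓ := by exact_mod_cast (lt_of_lt_of_le (by norm_num) hℓ)
  have hℓ3 : (3 : ℝ) ≤ ℓ := by exact_mod_cast hℓ
  set c : ℝ := 3 / ℓ with hc
  have hc0 : 0 < c := by rw [hc]; positivity
  have hc1 : c ≤ 1 := by rw [hc, div_le_one hℓpos]; exact hℓ3
  have hcinv : (ℓ : ℝ) / 3 * c = 1 := by rw [hc]; field_simp
  -- the leg-count model and its rescaling
  let B : Fin m → Matrix α β ℝ := fun j i k' =>
    ((Finset.univ.filter fun e => out e = j ∧ src e = i ∧ dst e = k').card : ℝ)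
  have hBdef : ∀ j i k', B j i k'
      = ((Finset.univ.filter fun e => out e = j ∧ src e = i ∧ dst e = k').card : ℝ) := fun _ _ _ => rfl
  let B' : Fin m → Matrix α β ℝ := fun j => c • B j
  have hB'def : ∀ j i k', B' j i k' = c * B j i k' := fun _ _ _ => rfl
  -- dictionary `M T = sgnMat B T = (ℓ/3) • sgnMat B' T`
  have hMT : ∀ T, M T = sgnMat B T := by
    intro T; ext i k'
    rw [hM T i k', sgnMat_legCount_eq src dst out B hBdef T i k']
  have hMT' : ∀ T, M T = ((ℓ : ℝ) / 3) • sgnMat B' T := by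
    intro T
    rw [show B' = fun j => c • B j from rfl, sgnMat_smul, smul_smul, hcinv, one_smul, hMT]
  have htr : ∀ T, ((Matrix.fromBlocks (0 : Matrix α α ℝ) (M T) (M T)ᵀ (0 : Matrix β β ℝ)) ^ (2 * k)).trace
      = ((ℓ : ℝ) / 3) ^ (2 * k) *
        ((Matrix.fromBlocks (0 : Matrix α α ℝ) (sgnMat B' T) (sgnMat B' T)ᵀ (0 : Matrix β β ℝ))
          ^ (2 * k)).trace := by
    intro T
    rw [hMT' T, fromBlocks_smul_offDiag, smul_pow, Matrix.trace_smul, smul_eq_mul]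
  simp_rw [htr]
  rw [← Finset.mul_sum]
  refine mul_le_mul_of_nonneg_left ?_ (by positivity)
  -- hypotheses of the abstract Prop. 7 for `B'`
  have hB0 : ∀ j i k', 0 ≤ B j i k' := fun _ _ _ => Nat.cast_nonneg _
  have hB'0 : ∀ j i k', 0 ≤ B' j i k' := fun j i k' => by rw [hB'def]; exact mul_nonneg hc0.le (hB0 j i k')
  have hlegsB : ∀ j, ∑ i, ∑ k', B j i k' = ((Finset.univ.filter fun e => out e = j).card : ℝ) := by
    intro j
    calc ∑ i, ∑ k', B j i k'
        = ∑ i : α, ∑ k' : β, ∑ e : E, (if out e = j ∧ src e = i ∧ dst e = k' then (1 : ℝ) else 0) := by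
          simp_rw [hBdef, legCount_eq_sum_ite]
      _ = ∑ i : α, ∑ e : E, ∑ k' : β, (if out e = j ∧ src e = i ∧ dst e = k' then (1 : ℝ) else 0) :=
          Finset.sum_congr rfl fun i _ => Finset.sum_comm
      _ = ∑ e : E, ∑ i : α, ∑ k' : β, (if out e = j ∧ src e = i ∧ dst e = k' then (1 : ℝ) else 0) :=
          Finset.sum_comm
      _ = ∑ e : E, (if out e = j then (1 : ℝ) else 0) :=
          Finset.sum_congr rfl fun e _ => sum_sum_ite_triple_out src dst out e j
      _ = ((Finset.univ.filter fun e => out e = j).card : ℝ) := by simp [Finset.sum_boole]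
  have hlegs : ∀ j, ∑ i, ∑ k', B' j i k' ≤ 3 := by
    intro j
    have h1 : ∑ i, ∑ k', B' j i k' = c * ∑ i, ∑ k', B j i k' := by
      simp_rw [hB'def]; rw [Finset.mul_sum]; exact Finset.sum_congr rfl fun i _ => by rw [Finset.mul_sum]
    rw [h1, hlegsB]
    have h2 : ((Finset.univ.filter fun e => out e = j).card : ℝ) ≤ ℓ := by exact_mod_cast hout j
    calc c * ((Finset.univ.filter fun e => out e = j).card : ℝ) ≤ c * ℓ :=
          mul_le_mul_of_nonneg_left h2 hc0.le
      _ = 3 := by rw [hc]; field_simp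
  have hrowB : ∀ i, ∑ j, ∑ k', B j i k' = ((Finset.univ.filter fun e => src e = i).card : ℝ) := by
    intro i
    calc ∑ j, ∑ k', B j i k'
        = ∑ j : Fin m, ∑ k' : β, ∑ e : E, (if out e = j ∧ src e = i ∧ dst e = k' then (1 : ℝ) else 0) := by
          simp_rw [hBdef, legCount_eq_sum_ite]
      _ = ∑ j : Fin m, ∑ e : E, ∑ k' : β, (if out e = j ∧ src e = i ∧ dst e = k' then (1 : ℝ) else 0) :=
          Finset.sum_congr rfl fun j _ => Finset.sum_comm
      _ = ∑ e : E, ∑ j : Fin m, ∑ k' : β, (if out e = j ∧ src e = i ∧ dst e = k' then (1 : ℝ) else 0) :=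
          Finset.sum_comm
      _ = ∑ e : E, (if src e = i then (1 : ℝ) else 0) :=
          Finset.sum_congr rfl fun e _ => sum_sum_ite_triple_row src dst out e i
      _ = ((Finset.univ.filter fun e => src e = i).card : ℝ) := by simp [Finset.sum_boole]
  have hrow : ∀ i, ∑ j, ∑ k', B' j i k' ≤ L := by
    intro i
    have h1 : ∑ j, ∑ k', B' j i k' = c * ∑ j, ∑ k', B j i k' := by
      simp_rw [hB'def]; rw [Finset.mul_sum]; exact Finset.sum_congr rfl fun j _ => by rw [Finset.mul_sum]
    rw [h1, hrowB]
    have h2 : ((Finset.univ.filter fun e => src e = i).card : ℝ) ≤ L :=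
      le_trans (by exact_mod_cast hdeg₁ i) hL₀
    have h3 : (0 : ℝ) ≤ ((Finset.univ.filter fun e => src e = i).card : ℝ) := Nat.cast_nonneg _
    calc c * ((Finset.univ.filter fun e => src e = i).card : ℝ)
        ≤ 1 * ((Finset.univ.filter fun e => src e = i).card : ℝ) := mul_le_mul_of_nonneg_right hc1 h3
      _ ≤ L := by rw [one_mul]; exact h2
  have hcolB : ∀ k', ∑ j, ∑ i, B j i k' = ((Finset.univ.filter fun e => dst e = k').card : ℝ) := by
    intro k'
    calc ∑ j, ∑ i, B j i k'
        = ∑ j : Fin m, ∑ i : α, ∑ e : E, (if out e = j ∧ src e = i ∧ dst e = k' then (1 : ℝ) else 0) := by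
          simp_rw [hBdef, legCount_eq_sum_ite]
      _ = ∑ j : Fin m, ∑ e : E, ∑ i : α, (if out e = j ∧ src e = i ∧ dst e = k' then (1 : ℝ) else 0) :=
          Finset.sum_congr rfl fun j _ => Finset.sum_comm
      _ = ∑ e : E, ∑ j : Fin m, ∑ i : α, (if out e = j ∧ src e = i ∧ dst e = k' then (1 : ℝ) else 0) :=
          Finset.sum_comm
      _ = ∑ e : E, (if dst e = k' then (1 : ℝ) else 0) :=
          Finset.sum_congr rfl fun e _ => sum_sum_ite_triple_col src dst out e k'
      _ = ((Finset.univ.filter fun e => dst e = k').card : ℝ) := by simp [Finset.sum_boole]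
  have hcol : ∀ k', ∑ j, ∑ i, B' j i k' ≤ L := by
    intro k'
    have h1 : ∑ j, ∑ i, B' j i k' = c * ∑ j, ∑ i, B j i k' := by
      simp_rw [hB'def]; rw [Finset.mul_sum]; exact Finset.sum_congr rfl fun j _ => by rw [Finset.mul_sum]
    rw [h1, hcolB]
    have h2 : ((Finset.univ.filter fun e => dst e = k').card : ℝ) ≤ L :=
      le_trans (by exact_mod_cast hdeg₂ k') hL₀
    have h3 : (0 : ℝ) ≤ ((Finset.univ.filter fun e => dst e = k').card : ℝ) := Nat.cast_nonneg _
    calc c * ((Finset.univ.filter fun e => dst e = k').card : ℝ)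
        ≤ 1 * ((Finset.univ.filter fun e => dst e = k').card : ℝ) := mul_le_mul_of_nonneg_right hc1 h3
      _ ≤ L := by rw [one_mul]; exact h2
  have hG' : ∀ j i k', B' j i k' ≠ 0 → G.Adj (Sum.inl i) (Sum.inr k') := by
    intro j i k' hne
    have hneB : B j i k' ≠ 0 := fun h0 => hne (by rw [hB'def, h0, mul_zero])
    have hne' : (Finset.univ.filter fun e => out e = j ∧ src e = i ∧ dst e = k').card ≠ 0 := by
      intro h0; apply hneB; simp only [hBdef, h0, Nat.cast_zero]
    obtain ⟨e, he⟩ := Finset.card_ne_zero.1 hne'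
    simp only [Finset.mem_filter, Finset.mem_univ, true_and] at he
    rw [← he.2.1, ← he.2.2]; exact hG e
  -- thresholds
  set γsp : ℝ := 3 * γR / ℓ with hγsp
  have hγ : γ' ≤ γsp := by
    rw [hγsp, le_div_iff₀ hℓpos]; linarith
  have hγsp0 : 0 < γsp := by
    have h144 : (0 : ℝ) < 144 * L * Real.log L := by
      have : 0 < Real.log L := Real.log_pos (by linarith)
      positivity
    have hγ'pos : 0 < γ' := by
      rcases hγ'.lt_or_eq with h | h
      · exact h
      · rw [← h] at hγ'L; norm_num at hγ'L; linarith
    exact lt_of_lt_of_le hγ'pos hγ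
  have hγspL : γsp ≤ L := by
    rw [hγsp, div_le_iff₀ hℓpos]; linarith
  -- unsigned sparseness in the `u, v` form, for `B'`
  have hsparse' : ∀ (u : α → ℝ) (v : β → ℝ), (∀ i, u i = 0 ∨ u i = 1) → (∀ k', v k' = 0 ∨ v k' = 1) →
      (G.induce {x | Sum.elim u v x = 1}).Connected → (∑ i, u i) + (∑ k', v k') ≤ t₀ →
      u ⬝ᵥ ((∑ j, B' j) *ᵥ v) ≤ γsp * Real.sqrt ((∑ i, u i) * (∑ k', v k')) := by
    intro u v hu hv hconn hsize
    set W₁ : Finset α := Finset.univ.filter fun i => u i = 1 with hW₁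
    set W₂ : Finset β := Finset.univ.filter fun k' => v k' = 1 with hW₂
    have hu_ind : ∀ i, u i = if i ∈ W₁ then 1 else 0 := by
      intro i; rcases hu i with h | h <;> simp [hW₁, h]
    have hv_ind : ∀ k', v k' = if k' ∈ W₂ then 1 else 0 := by
      intro k'; rcases hv k' with h | h <;> simp [hW₂, h]
    have hsumu : ∑ i, u i = (W₁.card : ℝ) := by
      rw [Finset.sum_congr rfl (fun i _ => hu_ind i), Finset.sum_boole]; simp
    have hsumv : ∑ k', v k' = (W₂.card : ℝ) := by
      rw [Finset.sum_congr rfl (fun k' _ => hv_ind k'), Finset.sum_boole]; simp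
    have hXeq : {x : α ⊕ β | Sum.elim u v x = 1} = {x | Sum.elim (fun i => i ∈ W₁) (fun j => j ∈ W₂) x} := by
      ext x; cases x with
      | inl i => simp [hW₁]
      | inr j => simp [hW₂]
    rw [hXeq] at hconn
    have hsize' : W₁.card + W₂.card ≤ t₀ := by
      have : ((W₁.card : ℝ) + W₂.card) ≤ t₀ := by rw [← hsumu, ← hsumv]; exact hsize
      exact_mod_cast this
    have hsp := hsparse W₁ W₂ hconn hsize'
    -- the bilinear form of the multiplicity matrix of `B` is the edge count
    have hform : u ⬝ᵥ ((∑ j, B j) *ᵥ v)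
        = ((Finset.univ.filter fun e => src e ∈ W₁ ∧ dst e ∈ W₂).card : ℝ) := by
      rw [bilin_eq_sum_legs src dst (fun _ => (1 : ℝ)) (∑ j, B j)
        (fun i k' => sum_legCount_apply src dst out B hBdef i k') u v]
      rw [Finset.sum_congr rfl (fun e _ => by rw [hu_ind (src e), hv_ind (dst e)])]
      have : ∀ e : E, (1 : ℝ) * (if src e ∈ W₁ then (1 : ℝ) else 0) * (if dst e ∈ W₂ then (1 : ℝ) else 0)
          = if src e ∈ W₁ ∧ dst e ∈ W₂ then 1 else 0 := by
        intro e; by_cases h1 : src e ∈ W₁ <;> by_cases h2 : dst e ∈ W₂ <;> simp [h1, h2]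
      simp_rw [this]
      simp [Finset.sum_boole]
    have hsumB' : ∑ j, B' j = c • ∑ j, B j := by
      rw [Finset.smul_sum]
    have hform' : u ⬝ᵥ ((∑ j, B' j) *ᵥ v) = c * (u ⬝ᵥ ((∑ j, B j) *ᵥ v)) := by
      rw [hsumB', Matrix.smul_mulVec, dotProduct_smul, smul_eq_mul]
    rw [hform', hform, hsumu, hsumv]
    have hsq0 : 0 ≤ Real.sqrt ((W₁.card : ℝ) * (W₂.card : ℝ)) := Real.sqrt_nonneg _
    calc c * ((Finset.univ.filter fun e => src e ∈ W₁ ∧ dst e ∈ W₂).card : ℝ)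
        ≤ c * (γR * Real.sqrt ((W₁.card : ℝ) * (W₂.card : ℝ))) := mul_le_mul_of_nonneg_left hsp hc0.le
      _ = γsp * Real.sqrt ((W₁.card : ℝ) * (W₂.card : ℝ)) := by rw [hγsp, hc]; ring
  have h := sum_trace_pow_le_explicit B' hB'0 hlegs hL hrow hcol G hG' hGdeg hLdeg hγ' hγ'L hγ hγsp0 hγspL
    t₀ hsparse' k
  exact h

end Summit.PneNP.PneNP.Theorems.Sd2Bl
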